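import Summits.Ventures.QEC.Census.BZAutPermChunks
import HarnessLib

/-!
# `bz_aut` with explicit-permutation automorphisms — FAST kernel replay (list walks, tables as verified data)
# (qec row 12, automorphism-orbit reduction; fourth file after `BZAutPerm`, `BZAutPermCover`, `BZAutPermChunks`)

The generic checks of `BZAutPerm.lean` / `BZAutPermCover.lean` look table entries up with `List.getD` inside per-bit
loops (`permWord (permFun perm) w n`, `composeTab`): `O(n²)` kernel steps per transported word — measured fine at
`n = 78` (the `ℤ₃₉` GB certificate, < 10 s in all) but not at `n = 270` (a `k = 16`, 134-automorphism `ℤ₃ × ℤ₄₅`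
certificate: one cover shard > 250 s).  This file gives the SAME checks in kernel-fast form with bridges to the landed
soundness theorems, so no statement changes:

* `permWordL perm w` — transport by walking the table (`O(n)`); `permWordL_eq_permWord` (unconditional);
  `wordApplyL n gens w v` — transport by a word LETTER BY LETTER (no table composition); `testBit_wordApplyL`,
  `wordApplyL_eq : wordApplyL n gens w v = permWord (permFun (wordPerm n gens w)) v n` (valid generators);
* `rowMapOKL` / `autGensOKFast` — the generator check walking rows and row maps in lockstep, and the bridge
  `autGensOK_of_fast : autGensOKFast … = true → autGensOK … = true` (the hypothesis of `bzAut_perm_hφ` and of every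
  closer in the companion files);
* `tabsOfWords n Ld L gens words` — the label-action tables of the listed words computed fast; an emitter ships their
  VALUE `tabs` as data and ONE `decide +kernel` checks `tabsOfWords … = tabs` (`tabsOfWords_eq`: they are the
  `rhoColsPerm` tables of `BZAutPermCover.lean`); the chunk checks `coverTabsRangeOK tabs blocks lo hi` (search form)
  and `coverTabsWitRangeOK tabs blocks lo hi witN b` (witnessed: ONE probe per label, packed `b`-bit witness fields,
  `witIdx`) then read the tables only, and `chunkCovered_of_tabsRangeOK(')` / `chunkCovered_of_tabsWitRangeOK(')`
  turn their verdicts into the `ChunkCovered` statements glued by `BZAutPermChunks.lean`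
  (`bzAut_perm_lower_of_chunkCovered`, `bzAut_perm_lower_sem_of_chunkCovered`, `bzAut_perm_hcover_of_chunkCovered`).

* labels WITHOUT popcounts: `colWords n Ld` (the column words of the label rows, `colMask`) and
  `xorSel_colWords : xorSel (colWords n Ld) v = labelWord n Ld v` — `n` cheap steps instead of `k` popcounts of
  `n`-bit words; `tabOfWord` / `tabsOfWords` take the column words as verified data (`colWords n Ld = cols`).

USE (side `Z`; data `gens = [g₀,…]`, `words`, `cols`, `tabs = [tab₀,…]`, `cuts = [0,…,2^k]`, `witNᵢ` emitted from the
certificate by the session tool `emit_autperm.py --fast`; each `decide +kernel` is ONE kernel evaluation):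
`cols_ok : colWords n bz.LX = cols`, `gen_ok_i : autGenOKFast n cert.HX cert.HZ gᵢ = true` (one per generator,
assembled by `autGensOKFast_cons … autGensOKFast_nil`), `words_ok : autWordsOK gens.length words = true`,
`tab_ok_j : tabOfWord n cols bz.LZ (autPerms gens) wⱼ = tabⱼ` (one per word, assembled by `tabsOfWords_cons`),
`cov_i : coverTabsWitRangeOK tabs bz.sideZ.blocks cᵢ cᵢ₊₁ witNᵢ b = true` (one per chunk); closer
`bzAut_perm_lower_of_chunkCovered hcomm hfound hcore hlen hblocks (autGensOK_of_fast gens_ok) words_ok cuts (by simp [cuts])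
(by rfl) (by decide) (fun i hi => by interval_cases i <;> exact chunkCovered_of_tabsWitRangeOK' gens_ok words_ok cols_ok
tabs_ok cov_‹i›) w hw hw'` (after bounding `i` from `hi`; `_sem_` variant for the lane-agnostic form).

MEASURED (farm kernel, `decide +kernel`, this session): `ℤ₃₉` GB `[[78,6,11]]` side `Z` (`n = 78`, `k = 6`, 6
generators, 2 words after greedy pruning, 2 chunks): the whole pipeline incl. the `hcover` assembly elaborates in < 6 s.
`ℤ₃ × ℤ₄₅` `[[270,16,6]]` side `Z` (`n = 270`, `k = 16`, 8 generators, 44 words, 4 chunks of 16384 labels): column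
words 0.2 s, ONE generator 8 s, ONE word table 1.4 s, ONE witnessed chunk 30 s (≈ 4 min for the side; the generic
forms of the companion files do not finish at this size).

HONEST FRAMING: no certificate is read here and no distance value is asserted; tier KERNEL, axioms standard, no
`native_decide`.  Sources as in the companion files ([Grassl 2006 §2.2], [Bravyi et al. 2024 SI §9.2]).
-/

namespace Summit.Ventures.QEC.Census

open Matrix Literature.InformationTheory.QuantumCodes

/-! ## Word transport along a permutation table by a LIST WALK (`O(n)` kernel steps) -/

section FastPerm

/-- `permWordL perm w`: the word `w` transported by the table `perm` (bit `q ↦ perm[q]`), computed by walking the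
table and halving `w` in lockstep — `O(n)` kernel steps (the generic `permWord (permFun perm) w n` looks every
`perm[q]` up from the head of the list: `O(n²)`). (definition) -/
def permWordL : List ℕ → ℕ → ℕ
  | [], _ => 0
  | p :: ps, w => (if w % 2 = 1 then 2 ^ p else 0) ^^^ permWordL ps (w / 2)

/-- `permWord` unrolled from the bottom bit. -/
private theorem permWord_succ_bottom (f : ℕ → ℕ) (w : ℕ) : ∀ q : ℕ,
    permWord f w (q + 1) = (if w.testBit 0 then 2 ^ f 0 else 0) ^^^ permWord (fun i => f (i + 1)) (w / 2) q
  | 0 => by simp [permWord]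
  | q + 1 => by
    rw [permWord, permWord_succ_bottom f w q, permWord, Nat.testBit_succ, Nat.xor_assoc]

/-- **The list walk computes `permWord`**: `permWordL perm w = permWord (permFun perm) w |perm|` (unconditionally). -/
theorem permWordL_eq_permWord : ∀ (perm : List ℕ) (w : ℕ),
    permWordL perm w = permWord (permFun perm) w perm.length
  | [], _ => rfl
  | p :: ps, w => by
    rw [permWordL, List.length_cons, permWord_succ_bottom, permWordL_eq_permWord ps (w / 2)]
    have h1 : (fun i => permFun (p :: ps) (i + 1)) = permFun ps := funext fun i => by simp [permFun]
    have h0 : permFun (p :: ps) 0 = p := by simp [permFun]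
    rw [h1, h0, Nat.testBit_zero]
    by_cases h : w % 2 = 1 <;> simp [h]

variable {n : ℕ}

/-- With a valid table: `permWordL perm w = permWord (permFun perm) w n`. -/
theorem permWordL_eq_of_permListOK {perm : List ℕ} (h : permListOK n perm = true) (w : ℕ) :
    permWordL perm w = permWord (permFun perm) w n := by
  rw [permWordL_eq_permWord, length_eq_of_permListOK h]

/-- Bits of `permWord` along a valid table: bit `j` is set iff `j = σ q` for some set bit `q < n` of `w`. -/
theorem testBit_permWord_permFun {perm : List ℕ} (h : permListOK n perm = true) (w j : ℕ) :
    (permWord (permFun perm) w n).testBit j = true ↔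
      ∃ q : Fin n, w.testBit q = true ∧ ((permEquiv n perm q : Fin n) : ℕ) = j := by
  have hinj : ∀ q₁ < n, ∀ q₂ < n, permFun perm q₁ = permFun perm q₂ → q₁ = q₂ := by
    intro q₁ h₁ q₂ h₂ he
    have := (permFin_bijective h).1 (a₁ := ⟨q₁, h₁⟩) (a₂ := ⟨q₂, h₂⟩) (Fin.ext he)
    exact congrArg Fin.val this
  rw [testBit_permWord (permFun perm) w hinj]
  constructor
  · rintro ⟨q, hq, hw, hj⟩
    exact ⟨⟨q, hq⟩, hw, by rw [permEquiv_val h]; exact hj⟩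
  · rintro ⟨q, hw, hj⟩
    exact ⟨q, q.2, hw, by rw [← permEquiv_val h]; exact hj⟩

/-- **Fast transport by a WORD in generator tables**, letter by letter (no table composition):
`wordApplyL n gens [g₁,…,g_s] v = σ_{g₁} · (⋯ (σ_{g_s} · v))` on the bits `< n` of `v`. (definition) -/
def wordApplyL (n : ℕ) (gens : List (List ℕ)) : List ℕ → ℕ → ℕ
  | [], v => v % 2 ^ n
  | g :: gs, v => permWordL (gens.getD g []) (wordApplyL n gens gs v)

variable {gens : List (List ℕ)}

/-- Bits of the fast word transport: bit `j` is set iff `j = (wordEquiv w) q` for some set bit `q < n` of `v`. -/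
theorem testBit_wordApplyL (hgens : ∀ g ∈ gens, permListOK n g = true) :
    ∀ (w : List ℕ), (∀ g ∈ w, g < gens.length) → ∀ (v j : ℕ),
      ((wordApplyL n gens w v).testBit j = true ↔
        ∃ q : Fin n, v.testBit q = true ∧ ((wordEquiv n gens w q : Fin n) : ℕ) = j)
  | [], _, v, j => by
    rw [wordApplyL, Nat.testBit_mod_two_pow]
    simp only [Bool.and_eq_true, decide_eq_true_eq, wordEquiv, Equiv.refl_apply]
    constructor
    · rintro ⟨hj, hv⟩
      exact ⟨⟨j, hj⟩, hv, rfl⟩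
    · rintro ⟨q, hv, rfl⟩
      exact ⟨q.2, hv⟩
  | g :: gs, hw, v, j => by
    have hg : g < gens.length := hw g (by simp)
    have hgs : ∀ g' ∈ gs, g' < gens.length := fun g' hg' => hw g' (by simp [hg'])
    have hval : gens.getD g [] = gens[g] := by
      rw [List.getD_eq_getElem?_getD, List.getElem?_eq_getElem hg, Option.getD_some]
    have hok : permListOK n gens[g] = true := hgens _ (List.getElem_mem hg)
    rw [wordApplyL, hval, permWordL_eq_of_permListOK hok, testBit_permWord_permFun hok]
    simp only [wordEquiv, Equiv.trans_apply, hval]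
    constructor
    · rintro ⟨q', hq', hj⟩
      obtain ⟨q, hv, hq⟩ := (testBit_wordApplyL hgens gs hgs v q').1 hq'
      refine ⟨q, hv, ?_⟩
      have : wordEquiv n gens gs q = q' := Fin.ext hq
      rw [this]
      exact hj
    · rintro ⟨q, hv, hj⟩
      exact ⟨wordEquiv n gens gs q, (testBit_wordApplyL hgens gs hgs v _).2 ⟨q, hv, rfl⟩, hj⟩

/-- **The fast word transport computes the table transport**:
`wordApplyL n gens w v = permWord (permFun (wordPerm n gens w)) v n` (valid generators, letters in range). -/
theorem wordApplyL_eq (hgens : ∀ g ∈ gens, permListOK n g = true) (w : List ℕ) (hw : ∀ g ∈ w, g < gens.length)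
    (v : ℕ) : wordApplyL n gens w v = permWord (permFun (wordPerm n gens w)) v n := by
  apply Nat.eq_of_testBit_eq
  intro j
  have hinj : ∀ q₁ < n, ∀ q₂ < n, permFun (wordPerm n gens w) q₁ = permFun (wordPerm n gens w) q₂ → q₁ = q₂ := by
    intro q₁ h₁ q₂ h₂ he
    rw [wordEquiv_val hgens w hw ⟨q₁, h₁⟩, wordEquiv_val hgens w hw ⟨q₂, h₂⟩] at he
    exact congrArg Fin.val ((wordEquiv n gens w).injective (Fin.ext he))
  rw [Bool.eq_iff_iff, testBit_wordApplyL hgens w hw v j, testBit_permWord _ v hinj]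
  constructor
  · rintro ⟨q, hv, hj⟩
    exact ⟨q, q.2, hv, by rw [wordEquiv_val hgens w hw q]; exact hj⟩
  · rintro ⟨q, hq, hv, hj⟩
    exact ⟨⟨q, hq⟩, hv, by rw [← wordEquiv_val hgens w hw ⟨q, hq⟩]; exact hj⟩

end FastPerm

/-! ## Fast generator check (row maps in lockstep) and its bridge to `autGensOK` -/

section FastGens

/-- **Fast automorphism check of one matrix**: `rows` has one entry per row and, walking `H` and `rows` together,
`H[rows[i]] = permWordL perm H[i]`. (definition, `decide +kernel`) -/
def rowMapOKL (H perm rows : List ℕ) : Bool :=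
  (rows.length == H.length) &&
    (H.zip rows).all fun hr => decide (hr.2 < H.length) && (H.getD hr.2 0 == permWordL perm hr.1)

variable {n : ℕ}

/-- The fast matrix check implies the generic one (valid table). -/
theorem rowMapOK_of_rowMapOKL {H perm rows : List ℕ} (hperm : permListOK n perm = true)
    (h : rowMapOKL H perm rows = true) : rowMapOK n H perm rows = true := by
  simp only [rowMapOKL, Bool.and_eq_true, beq_iff_eq, List.all_eq_true, decide_eq_true_eq] at h
  obtain ⟨hlen, hall⟩ := h
  simp only [rowMapOK, List.all_eq_true, List.mem_range, Bool.and_eq_true, decide_eq_true_eq, beq_iff_eq]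
  intro i hi
  have hi' : i < rows.length := by rw [hlen]; exact hi
  have hmem : (H[i], rows[i]) ∈ H.zip rows := by
    rw [List.mem_iff_getElem]
    exact ⟨i, by rw [List.length_zip]; exact lt_min hi hi', by rw [List.getElem_zip]⟩
  obtain ⟨hlt, heq⟩ := hall _ hmem
  simp only at hlt heq
  have e1 : rows.getD i 0 = rows[i] := by
    rw [List.getD_eq_getElem?_getD, List.getElem?_eq_getElem hi', Option.getD_some]
  have e2 : H.getD i 0 = H[i] := by
    rw [List.getD_eq_getElem?_getD, List.getElem?_eq_getElem hi, Option.getD_some]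
  rw [e1, e2]
  exact ⟨hlt, by rw [heq, permWordL_eq_of_permListOK hperm]⟩

/-- **Fast check of ONE generator**: valid table and both row-map checks in the fast form — one `decide +kernel` per
generator (`≈ 30 s` at `n = 270`), assembled by `autGensOKFast_cons`. (definition) -/
def autGenOKFast (n : ℕ) (Hsyn Hstab : List ℕ) (a : AutGen) : Bool :=
  permListOK n a.perm && rowMapOKL Hsyn a.perm a.rowsSyn && rowMapOKL Hstab a.perm a.rowsStab

/-- **Fast generator check** of a generator list. (definition) -/
def autGensOKFast (n : ℕ) (Hsyn Hstab : List ℕ) (gens : List AutGen) : Bool := gens.all (autGenOKFast n Hsyn Hstab)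

/-- Assembly of per-generator verdicts: `autGensOKFast` of `a :: gens`. -/
theorem autGensOKFast_cons {Hsyn Hstab : List ℕ} {a : AutGen} {gens : List AutGen}
    (ha : autGenOKFast n Hsyn Hstab a = true) (hg : autGensOKFast n Hsyn Hstab gens = true) :
    autGensOKFast n Hsyn Hstab (a :: gens) = true := by
  rw [autGensOKFast, List.all_cons, ha, Bool.true_and]
  exact hg

/-- The empty generator list checks. -/
theorem autGensOKFast_nil {Hsyn Hstab : List ℕ} : autGensOKFast n Hsyn Hstab [] = true := rfl

/-- **Bridge**: the fast generator check implies `autGensOK` (the hypothesis of `bzAut_perm_hφ` and of every closer). -/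
theorem autGensOK_of_fast {Hsyn Hstab : List ℕ} {gens : List AutGen} (h : autGensOKFast n Hsyn Hstab gens = true) :
    autGensOK n Hsyn Hstab gens = true := by
  simp only [autGensOKFast, autGenOKFast, List.all_eq_true, Bool.and_eq_true] at h
  simp only [autGensOK, List.all_eq_true, Bool.and_eq_true]
  intro a ha
  obtain ⟨⟨hp, hs⟩, ht⟩ := h a ha
  exact ⟨⟨hp, rowMapOK_of_rowMapOKL hp hs⟩, rowMapOK_of_rowMapOKL hp ht⟩

end FastGens

/-! ## Labels through COLUMN words (no popcounts): `labelWord n Ld v = xorSel (colWords n Ld) v` -/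

section Labels

/-- The column words of the label rows: `colWords n Ld = [colMask Ld 0, …, colMask Ld (n−1)]` (bit `i` of entry `q` =
bit `q` of `Ld[i]`). The label of `v` is then `xorSel (colWords n Ld) v` — `n` cheap steps instead of `k` popcounts
of `n`-bit words (`labelWord`: `≈ 8×` more kernel steps at `k = 16`). (definition) -/
def colWords (n : ℕ) (Ld : List ℕ) : List ℕ := (List.range n).map (colMask Ld)

/-- A label word has only its `k = |Ld|` low bits. -/
theorem labelWord_lt (n : ℕ) : ∀ (Ld : List ℕ) (v : ℕ), labelWord n Ld v < 2 ^ Ld.length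
  | [], v => by simp [labelWord]
  | d :: ds, v => by
    rw [labelWord, List.length_cons, Nat.pow_succ]
    have h1 := Nat.mod_lt (popc n (d &&& v)) (show 0 < 2 by decide)
    have h2 := labelWord_lt n ds v
    omega

/-- **Labels through column words**: `xorSel (colWords n Ld) v = labelWord n Ld v`. -/
theorem xorSel_colWords (n : ℕ) (Ld : List ℕ) (v : ℕ) : xorSel (colWords n Ld) v = labelWord n Ld v := by
  have hlen : (colWords n Ld).length = n := by simp [colWords]
  have hlt : ∀ g ∈ colWords n Ld, g < 2 ^ Ld.length := by
    intro g hg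
    obtain ⟨q, -, rfl⟩ := List.mem_map.1 hg
    exact colMask_lt Ld q
  apply Summit.Ventures.QEC.ofBits_inj (xorSel_lt _ _ hlt v) (labelWord_lt n Ld v)
  funext i
  change ofBits Ld.length (xorSel (colWords n Ld) v) i = ofBits Ld.length (labelWord n Ld v) i
  rw [ofBits_xorSel_eq_vecMul, ofBits_labelWord_apply, vecMul, dotProduct, dotProduct]
  -- `∑_q v_q · C q i = ∑_q Ld[i]_q · v_q`, the rows of `C = rowMatrix k (colWords n Ld)` being the columns of `Ld`
  refine Fintype.sum_equiv (finCongr hlen) _ _ fun q => ?_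
  have hq : (colWords n Ld)[(q : ℕ)]'q.2 = colMask Ld q := by simp [colWords]
  have e1 : rowMatrix Ld.length (colWords n Ld) q i = ofBits n (Ld.getD i 0) (finCongr hlen q) := by
    simp only [rowMatrix, Fin.getElem_fin, hq, finCongr_apply]
    change (if (colMask Ld q).testBit i then (1 : ZMod 2) else 0) = if (Ld.getD i 0).testBit q then 1 else 0
    rw [testBit_colMask Ld q i i.2, List.getD_eq_getElem?_getD, List.getElem?_eq_getElem i.2, Option.getD_some]
  have e2 : ofBits (colWords n Ld).length v q = ofBits n v (finCongr hlen q) := rfl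
  rw [e1, e2, mul_comm]

end Labels

/-! ## Label-action tables as DATA, verified per word; chunk checks on the tables -/

section Tabs

/-- **The label-action table of ONE word, fast**: the `k` columns of `ρ_w` as label words, column `j` = label (through
the column words `cols = colWords n Ld`) of `wordApplyL n gens w L[j]`. One `decide +kernel` per word checks its VALUE
against emitted data. (definition) -/
def tabOfWord (n : ℕ) (cols L : List ℕ) (gens : List (List ℕ)) (w : List ℕ) : List ℕ :=
  L.map fun lz => xorSel cols (wordApplyL n gens w lz)

/-- **The tables of the listed words** (`= words.map (tabOfWord …)`); the chunk checks below read their VALUE `tabs`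
(data) only, after `tabsOfWords … = tabs` is established (per word, `tabsOfWords_cons`). (definition) -/
def tabsOfWords (n : ℕ) (cols L : List ℕ) (gens words : List (List ℕ)) : List (List ℕ) :=
  words.map (tabOfWord n cols L gens)

variable {n : ℕ}

/-- Assembly of per-word table verdicts. -/
theorem tabsOfWords_cons {cols L : List ℕ} {gens : List (List ℕ)} {w : List ℕ} {ws : List (List ℕ)} {t : List ℕ}
    {ts : List (List ℕ)} (hw : tabOfWord n cols L gens w = t) (hws : tabsOfWords n cols L gens ws = ts) :
    tabsOfWords n cols L gens (w :: ws) = t :: ts := by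
  rw [tabsOfWords, List.map_cons, hw, ← hws, tabsOfWords]

/-- The empty word list has no tables. -/
theorem tabsOfWords_nil {cols L : List ℕ} {gens : List (List ℕ)} : tabsOfWords n cols L gens [] = [] := rfl

/-- The fast tables ARE the tables of `BZAutPermCover.lean` (`rhoColsPerm` of the words' composed tables), given the
column words of `Ld`. -/
theorem tabsOfWords_eq {Ld L cols : List ℕ} {gens words : List (List ℕ)} (hgens : ∀ g ∈ gens, permListOK n g = true)
    (hwords : ∀ w ∈ words, ∀ g ∈ w, g < gens.length) (hcols : colWords n Ld = cols) :
    tabsOfWords n cols L gens words = words.map fun w => rhoColsPerm n Ld L (wordPerm n gens w) := by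
  subst hcols
  unfold tabsOfWords tabOfWord
  refine List.map_congr_left fun w hw => ?_
  unfold rhoColsPerm
  refine List.map_congr_left fun lz _ => ?_
  rw [xorSel_colWords, wordApplyL_eq hgens w (hwords w hw)]

/-- **Chunk check on tables, search form**: labels `lo ≤ v < hi`; `v = 0`, or in the cover mask, or some table's
probe `xorSel cols v` is. (definition, `decide +kernel`) -/
def coverTabsRangeOK (tabs : List (List ℕ)) (blocks : List BZBlock) (lo hi : ℕ) : Bool :=
  let cm := coverMask blocks
  (List.range' lo (hi - lo)).all fun v => (v == 0) || cm.testBit v || tabs.any fun cols => cm.testBit (xorSel cols v)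

/-- **Chunk check on tables, witnessed form** (one probe per label; `witIdx witN b lo v` = the table to use).
(definition, `decide +kernel`) -/
def coverTabsWitRangeOK (tabs : List (List ℕ)) (blocks : List BZBlock) (lo hi witN b : ℕ) : Bool :=
  let cm := coverMask blocks
  (List.range' lo (hi - lo)).all fun v =>
    (v == 0) || cm.testBit v ||
      (decide (witIdx witN b lo v < tabs.length) && cm.testBit (xorSel (tabs.getD (witIdx witN b lo v) []) v))

/-- The search form on verified tables establishes its chunk. -/
theorem chunkCovered_of_tabsRangeOK {Ld L : List ℕ} {gens words : List (List ℕ)} {blocks : List BZBlock}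
    {cols : List ℕ} {tabs : List (List ℕ)} {lo hi : ℕ} (hgens : ∀ g ∈ gens, permListOK n g = true)
    (hwords : ∀ w ∈ words, ∀ g ∈ w, g < gens.length) (hcols : colWords n Ld = cols)
    (htabs : tabsOfWords n cols L gens words = tabs)
    (h : coverTabsRangeOK tabs blocks lo hi = true) : ChunkCovered n Ld L gens words blocks lo hi := by
  subst htabs
  rw [tabsOfWords_eq hgens hwords hcols] at h
  intro v hlo hhi hv0
  simp only [coverTabsRangeOK, List.all_eq_true, List.mem_range'_1, Bool.or_eq_true, beq_iff_eq, List.any_eq_true,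
    List.mem_map] at h
  rcases h v ⟨hlo, by omega⟩ with (h0 | hbit) | ⟨cols, ⟨w, hw, rfl⟩, hbit⟩
  · exact absurd h0 hv0
  · exact Or.inl hbit
  · exact Or.inr ⟨w, hw, hbit⟩

/-- The witnessed form on verified tables establishes its chunk. -/
theorem chunkCovered_of_tabsWitRangeOK {Ld L : List ℕ} {gens words : List (List ℕ)} {blocks : List BZBlock}
    {cols : List ℕ} {tabs : List (List ℕ)} {lo hi witN b : ℕ} (hgens : ∀ g ∈ gens, permListOK n g = true)
    (hwords : ∀ w ∈ words, ∀ g ∈ w, g < gens.length) (hcols : colWords n Ld = cols)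
    (htabs : tabsOfWords n cols L gens words = tabs)
    (h : coverTabsWitRangeOK tabs blocks lo hi witN b = true) : ChunkCovered n Ld L gens words blocks lo hi := by
  subst htabs
  rw [tabsOfWords_eq hgens hwords hcols] at h
  intro v hlo hhi hv0
  simp only [coverTabsWitRangeOK, List.all_eq_true, List.mem_range'_1, Bool.or_eq_true, beq_iff_eq,
    Bool.and_eq_true, decide_eq_true_eq, List.length_map] at h
  rcases h v ⟨hlo, by omega⟩ with (h0 | hbit) | ⟨hidx, hbit⟩
  · exact absurd h0 hv0
  · exact Or.inl hbit
  · refine Or.inr ⟨words[witIdx witN b lo v], List.getElem_mem hidx, ?_⟩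
    have htab : (words.map fun w => rhoColsPerm n Ld L (wordPerm n gens w)).getD (witIdx witN b lo v) [] =
        rhoColsPerm n Ld L (wordPerm n gens words[witIdx witN b lo v]) := by
      rw [List.getD_eq_getElem?_getD, List.getElem?_map, List.getElem?_eq_getElem hidx, Option.map_some,
        Option.getD_some]
    rw [← htab]
    exact hbit

/-- The same two adapters with the hypotheses in CERTIFICATE form (`autGensOKFast`, `autWordsOK` on `AutGen` data),
search form. -/
theorem chunkCovered_of_tabsRangeOK' {Hsyn Hstab : List ℕ} {gens : List AutGen}
    (hgens : autGensOKFast n Hsyn Hstab gens = true) {words : List (List ℕ)}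
    (hwords : autWordsOK gens.length words = true) {Ld L cols : List ℕ} {blocks : List BZBlock}
    {tabs : List (List ℕ)} {lo hi : ℕ} (hcols : colWords n Ld = cols)
    (htabs : tabsOfWords n cols L (autPerms gens) words = tabs)
    (h : coverTabsRangeOK tabs blocks lo hi = true) : ChunkCovered n Ld L (autPerms gens) words blocks lo hi :=
  chunkCovered_of_tabsRangeOK (permListOK_of_autGensOK (autGensOK_of_fast hgens))
    (fun w hw => by rw [List.length_map]; exact lt_of_autWordsOK hwords hw) hcols htabs h

/-- Certificate-form adapter, witnessed form. -/
theorem chunkCovered_of_tabsWitRangeOK' {Hsyn Hstab : List ℕ} {gens : List AutGen}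
    (hgens : autGensOKFast n Hsyn Hstab gens = true) {words : List (List ℕ)}
    (hwords : autWordsOK gens.length words = true) {Ld L cols : List ℕ} {blocks : List BZBlock}
    {tabs : List (List ℕ)} {lo hi witN b : ℕ} (hcols : colWords n Ld = cols)
    (htabs : tabsOfWords n cols L (autPerms gens) words = tabs)
    (h : coverTabsWitRangeOK tabs blocks lo hi witN b = true) :
    ChunkCovered n Ld L (autPerms gens) words blocks lo hi :=
  chunkCovered_of_tabsWitRangeOK (permListOK_of_autGensOK (autGensOK_of_fast hgens))
    (fun w hw => by rw [List.length_map]; exact lt_of_autWordsOK hwords hw) hcols htabs h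

end Tabs

/-! ## Smoke tests (kernel `decide`) -/

/-- The list walk agrees with the generic transport on the swap of two halves of `4` qubits. -/
example : permWordL [2, 3, 0, 1] 3 = 12 ∧ permWord (permFun [2, 3, 0, 1]) 3 4 = 12 := by decide

/-- Fast generator check on the `4`-qubit example (`H = [0011₂, 1100₂]` twice, swap, row maps `[1,0]`). -/
example : autGensOKFast 4 [3, 12] [3, 12] [⟨[2, 3, 0, 1], [1, 0], [1, 0]⟩] = true := by decide

/-- `labelWord` through column words on `n = 4`, `Ld = [0011₂, 0110₂]`, `v = 0111₂`: label `01₂`... computed both ways. -/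
example : xorSel (colWords 4 [3, 6]) 7 = labelWord 4 [3, 6] 7 := by decide

/-- Tables of the two-logical swap example: column words of `Ld = [01₂, 10₂]` are `[1, 2]`; one word `[0]`,
`tabsOfWords 2 [1,2] [1,2] [[1,0]] [[0]] = [[2, 1]]`, and the chunk `[2,4)` checks on that table in both forms. -/
example : colWords 2 [1, 2] = [1, 2] ∧ tabsOfWords 2 [1, 2] [1, 2] [[1, 0]] [[0]] = [[2, 1]] ∧
    coverTabsRangeOK [[2, 1]] [⟨[1], []⟩, ⟨[3], []⟩] 2 4 = true ∧
    coverTabsWitRangeOK [[2, 1]] [⟨[1], []⟩, ⟨[3], []⟩] 2 4 0 1 = true ∧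
    coverTabsRangeOK [[2, 1]] [⟨[1], []⟩] 2 4 = false := by decide

end Summit.Ventures.QEC.Census
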